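import Mathlib.Analysis.ODE.Gronwall
import Literature.MathematicalPhysics.QuantumLattice.LiebRobinson
import Literature.MathematicalPhysics.QuantumLattice.LiebRobinsonIntegralProofs
import Literature.MathematicalPhysics.QuantumLattice.SpinSystemProofs
import Literature.MathematicalPhysics.QuantumLattice.CorrelationLightConeLattice
import Literature.Computability.QuantumComplexity.PlaceGateNorm
import HarnessLib

/-!
# Proof of the Lieb–Robinson bound `lieb_robinson` (hubbard.S17)

Sibling proof file of `LiebRobinson.lean`: it discharges the named fact
`Literature.MathematicalPhysics.QuantumLattice.lieb_robinson` (Nachtergaele–Ogata–Sims, J. Stat.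
Phys. **124** (2006) 1 = arXiv:math-ph/0603064, §2.1, Theorem 2.1 "Lieb–Robinson Bound", in the
multi-site `min(|X|, |Y|)` form of the display following its proof) as
`theorem lieb_robinson_holds : lieb_robinson d q`, with the explicit constants `C = 2`, `μ = 1`,
`v = 2 max(J,1) M N e^{max(R,0)}`, `M = (2⌊max(R,0)⌋+1)^d`, `N = 2^M`. No definition and no named
fact is introduced (theorems only).

## The printed proof and how it is followed

NOS06, proof of Thm 2.1: for `A ∈ 𝔄_X`, `B ∈ 𝔄_Y`, `f(t) = [τ_t(A), B]` satisfies
`f'(t) = i[f(t), τ_t(H_X)] + i[τ_t(A), [τ_t(H_X), B]]` with `H_X = Σ_{Z ∩ X ≠ ∅} Φ(Z)`; the first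
term is norm-preserving (their Lemma 4.1), whence the integral inequality
`‖[τ_t(A), B]‖ ≤ ‖[A, B]‖ + 2‖A‖ ∫₀^{|t|} ‖[τ_s(H_X), B]‖ ds`, then
`C_B(X,t) ≤ C_B(X,0) + 2 Σ_{Z ∩ X ≠ ∅} ‖Φ(Z)‖ ∫₀^{|t|} C_B(Z,s) ds`, which is iterated into the
series `2‖B‖ Σ_n (2|t|)^n a_n / n!` and summed with the lattice combinatorics of `‖Φ‖_a`, `C_a`.

* The differential step is taken from the tree in its interaction-picture form
  (`LiebRobinsonIntegralProofs`: `hasDerivAt_interactionPicture`, `norm_interactionPicture_deriv`,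
  `comm_heisenbergEvolution_eq_conj`): with `P = Σ_{Z ∩ X = ∅} Φ Z` (which commutes with `A`) and
  `G(t) = e^{itP} τ_{-t}(B) e^{-itP}` one has `‖[τ_t(A), B]‖ = ‖[A, G(t)]‖` and
  `‖G'(t)‖ = ‖[τ_t(H - P), B]‖ ≤ Σ_{Z ∩ X ≠ ∅} ‖[τ_t(Φ Z), B]‖` — the differential form of the
  integral inequality.
* **Deviation (a genuinely shorter road in Lean).** Instead of iterating the integral inequality
  (the series `a_n` and its combinatorial estimate), the finite family of weighted commutator
  functions `t ↦ e^{d(Z,Y)} [Φ Z, G_Z(t)]`, `Z ⊆ Λ`, together with `e^{d(X,Y)} [A, G_X(t)]`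
  (suitably normalised), is fed to **Grönwall's lemma** (Mathlib
  `norm_le_gronwallBound_of_norm_deriv_right_le`, sup norm on the product): the closure property
  `‖f'‖ ≤ K ‖f‖` holds with `K = 2 max(J,1) M N e^{max(R,0)}` because a non-zero term `Φ Z'` meeting
  `Z` has `|Z'| ≤ M`, there are at most `|Z| N` of them, and `d(Z, Y) ≤ d(Z', Y) + R`
  (`weighted_norm_commutator_le_of_closed_family`, stated abstractly for matrices). This gives
  `‖[τ_t(A), B]‖ ≤ 2‖A‖ ‖B‖ |X| e^{-(d(X,Y) - K|t|)}` (`lieb_robinson_bound_left`), and the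
  `min(|X|, |Y|)` prefactor follows from the symmetry `‖[τ_t(A), B]‖ = ‖[τ_{-t}(B), A]‖`.
* Lattice bookkeeping (`ℤ^d`, sup metric): `card_filter_dist_le` (a sup-ball of radius `r` in a
  volume has `≤ (2⌊r⌋+1)^d` sites, via `box`), `card_le_of_forall_mem_active`,
  `card_le_of_forall_mem_meets_active`, `setDist_le_setDist_add`, and the degenerate cases
  `q = 0` (all observables commute), `A = 0`, `X = ∅` (`𝔄_∅ = ℂ𝟙`).

## References

* B. Nachtergaele, Y. Ogata, R. Sims, *Propagation of correlations in quantum lattice systems*,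
  J. Stat. Phys. **124** (2006) 1–13, arXiv:math-ph/0603064, §2.1 Thm 2.1 and the display
  following its proof (`min(|X|,|Y|)` form, velocity `2‖Φ‖_a C_a / a`).
  [NachtergaeleOgataSimsJSP2006]
* B. Nachtergaele, R. Sims, *Lieb–Robinson bounds and the exponential clustering theorem*,
  Comm. Math. Phys. **265** (2006) 119–130, Thm 1. [NachtergaeleSims2006]
* Mathlib: `norm_le_gronwallBound_of_norm_deriv_right_le`, `gronwallBound_ε0`, `hasDerivAt_pi`,
  `pi_norm_le_iff_of_nonneg`; the tree: `norm_heisenbergEvolution_holds`,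
  `commute_of_disjoint_holds`, `norm_localOp_holds`,
  `Literature.Computability.QuantumComplexity.l2_opNorm_reindex`,
  `exists_eq_smul_one_of_isSupportedOn_empty`.
-/

noncomputable section

open Matrix Complex Finset NormedSpace
open scoped Matrix.Norms.L2Operator

namespace Literature.MathematicalPhysics.QuantumLattice

section Analysis

variable {n : Type*} [Fintype n] [DecidableEq n]

/-- `τ_t` is linear: differences. Bratteli–Robinson II §6.2.1. [folklore] -/
theorem heisenbergEvolution_sub (H : Matrix n n ℂ) (t : ℝ) (A B : Matrix n n ℂ) :
    heisenbergEvolution H t (A - B) = heisenbergEvolution H t A - heisenbergEvolution H t B := by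
  simp [heisenbergEvolution, mul_sub, sub_mul]

/-- `τ_t` is linear: finite sums. Bratteli–Robinson II §6.2.1. [folklore] -/
theorem heisenbergEvolution_sum {ι : Type*} (s : Finset ι) (H : Matrix n n ℂ) (t : ℝ)
    (A : ι → Matrix n n ℂ) :
    heisenbergEvolution H t (∑ i ∈ s, A i) = ∑ i ∈ s, heisenbergEvolution H t (A i) := by
  simp [heisenbergEvolution, Finset.mul_sum, Finset.sum_mul]

/-- `τ_t ∘ τ_{-t} = id`. Bratteli–Robinson II §6.2.1. [folklore] -/
theorem heisenbergEvolution_neg_cancel (H : Matrix n n ℂ) (t : ℝ) (A : Matrix n n ℂ) :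
    heisenbergEvolution H t (heisenbergEvolution H (-t) A) = A := by
  rw [← heisenbergEvolution_add, add_neg_cancel, heisenbergEvolution_zero]

/-- Commutator transport: `‖[M, τ_{-u}(B)]‖ = ‖[τ_u(M), B]‖` for Hermitian `H` (unitary
invariance of the norm and `τ_u ∘ τ_{-u} = id`). NOS06 proof of Thm 2.1 ("the automorphism
property of `τ_t`"). [folklore] -/
theorem norm_commutator_heisenbergEvolution_neg {H : Matrix n n ℂ} (hH : H.IsHermitian) (u : ℝ)
    (M B : Matrix n n ℂ) :
    ‖M * heisenbergEvolution H (-u) B - heisenbergEvolution H (-u) B * M‖ =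
      ‖heisenbergEvolution H u M * B - B * heisenbergEvolution H u M‖ := by
  rw [← norm_heisenbergEvolution_holds hH u (M * _ - _ * M), heisenbergEvolution_sub,
    heisenbergEvolution_mul, heisenbergEvolution_mul, heisenbergEvolution_neg_cancel]

/-- **Interaction-picture identity for the norm.** If the Hermitian `H'` commutes with `A`, then
for Hermitian `H`, `‖[τ_t^H(A), B]‖ = ‖[A, G(t)]‖` with the interaction-picture observable
`G(t) = e^{itH'} τ_{-t}^H(B) e^{-itH'}` (`comm_heisenbergEvolution_eq_conj` and unitary
invariance; this is Step 1 of `norm_comm_heisenbergEvolution_le`). NOS06 proof of Thm 2.1.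
[folklore] -/
theorem norm_comm_heisenbergEvolution_eq_interactionPicture {H H' A : Matrix n n ℂ}
    (hH : H.IsHermitian) (hH' : H'.IsHermitian) (hc : Commute H' A) (B : Matrix n n ℂ) (t : ℝ) :
    ‖heisenbergEvolution H t A * B - B * heisenbergEvolution H t A‖ =
      ‖A * (exp (t • (I • H')) * heisenbergEvolution H (-t) B * exp (t • (-(I • H')))) -
        exp (t • (I • H')) * heisenbergEvolution H (-t) B * exp (t • (-(I • H'))) * A‖ := by
  have hGt : exp (t • (I • H')) * heisenbergEvolution H (-t) B * exp (t • (-(I • H'))) =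
      exp (t • (I • H')) * exp (t • (-(I • H))) * B *
        (exp (t • (I • H)) * exp (t • (-(I • H')))) := by
    simp only [heisenbergEvolution_eq_exp_smul, neg_smul, smul_neg, neg_neg, Matrix.mul_assoc]
  have hU : exp (t • (I • H)) * exp (t • (-(I • H'))) ∈ unitary (Matrix n n ℂ) :=
    mul_mem (exp_smul_I_smul_mem_unitary hH t) (exp_smul_neg_I_smul_mem_unitary hH' t)
  have hV : exp (t • (I • H')) * exp (t • (-(I • H))) ∈ unitary (Matrix n n ℂ) :=
    mul_mem (exp_smul_I_smul_mem_unitary hH' t) (exp_smul_neg_I_smul_mem_unitary hH t)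
  rw [comm_heisenbergEvolution_eq_conj hc t B, norm_unitary_mul_mul_unitary hU hV, hGt]

/-- `‖[A, M]‖ ≤ 2 ‖A‖ ‖M‖` (the trivial bound `C_B(Z, 0) ≤ 2‖B‖ δ_Y(Z)` in the proof of NOS06
Thm 2.1). [folklore] -/
theorem norm_commutator_le (A M : Matrix n n ℂ) : ‖A * M - M * A‖ ≤ 2 * ‖A‖ * ‖M‖ := by
  calc ‖A * M - M * A‖ ≤ ‖A * M‖ + ‖M * A‖ := norm_sub_le _ _
    _ ≤ ‖A‖ * ‖M‖ + ‖M‖ * ‖A‖ := add_le_add (norm_mul_le _ _) (norm_mul_le _ _)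
    _ = 2 * ‖A‖ * ‖M‖ := by ring

/-- The commutator with a finite sum is bounded by the sum of the commutator norms. [folklore] -/
theorem norm_sum_commutator_le {κ : Type*} (s : Finset κ) (O : κ → Matrix n n ℂ)
    (M : Matrix n n ℂ) :
    ‖(∑ j ∈ s, O j) * M - M * ∑ j ∈ s, O j‖ ≤ ∑ j ∈ s, ‖O j * M - M * O j‖ := by
  rw [Finset.sum_mul, Finset.mul_sum, ← Finset.sum_sub_distrib]
  exact norm_sum_le _ _

/-- Grönwall for all times: if `‖f'(t)‖ ≤ K ‖f(t)‖` everywhere then `‖f t‖ ≤ ‖f 0‖ e^{K|t|}`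
(Mathlib's `norm_le_gronwallBound_of_norm_deriv_right_le` with `ε = 0`, applied on `[0, t]` to
`f` and on `[0, -t]` to `s ↦ f (-s)`). [folklore] -/
theorem norm_le_mul_exp_of_norm_deriv_le {E : Type*} [NormedAddCommGroup E] [NormedSpace ℝ E]
    {f f' : ℝ → E} {K : ℝ} (hf : ∀ t, HasDerivAt f (f' t) t) (hb : ∀ t, ‖f' t‖ ≤ K * ‖f t‖)
    (t : ℝ) : ‖f t‖ ≤ ‖f 0‖ * Real.exp (K * |t|) := by
  rcases le_total 0 t with ht | ht
  · have h := norm_le_gronwallBound_of_norm_deriv_right_le (f := f) (f' := f') (a := 0) (b := t)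
      (δ := ‖f 0‖) (K := K) (ε := 0) (fun x _ => (hf x).continuousAt.continuousWithinAt)
      (fun x _ => (hf x).hasDerivWithinAt) le_rfl (fun x _ => by simpa using hb x) t
      ⟨ht, le_rfl⟩
    simpa [gronwallBound_ε0, abs_of_nonneg ht] using h
  · have hg : ∀ s, HasDerivAt (fun s => f (-s)) (-(f' (-s))) s := fun s => by
      have := (hf (-s)).scomp s (hasDerivAt_neg s)
      simpa [Function.comp_def] using this
    have h := norm_le_gronwallBound_of_norm_deriv_right_le (f := fun s => f (-s))
      (f' := fun s => -(f' (-s))) (a := 0) (b := -t) (δ := ‖f 0‖) (K := K) (ε := 0)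
      (fun x _ => (hg x).continuousAt.continuousWithinAt) (fun x _ => (hg x).hasDerivWithinAt)
      (by simp) (fun x _ => by simpa [norm_neg] using hb (-x)) (-t) ⟨neg_nonneg.2 ht, le_rfl⟩
    simpa [gronwallBound_ε0, abs_of_nonpos ht] using h

end Analysis

section AbstractLR

variable {n : Type*} [Fintype n] [DecidableEq n]

/-- **Weighted Grönwall form of the Lieb–Robinson integral inequality** (abstractly, for
matrices; replaces the iteration of NOS06's inequality for `C_B(X, t)` in the proof of Thm 2.1).
Let `H` be Hermitian and `B` fixed. Suppose a finite family of "probes" `O k` with Hermitian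
"exterior Hamiltonians" `P k` commuting with `O k` is closed in the sense that
`H - P k = Σ_{j ∈ S k} O j`, and positive weights `w` satisfy
`2 ‖O k‖ w k Σ_{j ∈ S k} (w j)⁻¹ ≤ K` and `w k ‖[O k, B]‖ ≤ δ`. Then
`w k ‖[τ_t(O k), B]‖ ≤ δ e^{K |t|}` for all `k` and `t`. Proof: the product-valued function
`f(t)_k = w k [O k, G_k(t)]`, `G_k(t) = e^{itP_k} τ_{-t}(B) e^{-itP_k}`, has
`‖f(t)_k‖ = w k ‖[τ_t(O k), B]‖` (`norm_comm_heisenbergEvolution_eq_interactionPicture`) and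
`‖f'(t)‖ ≤ K ‖f(t)‖` (`norm_interactionPicture_deriv` and the closure property), so Grönwall
applies. [cite: NachtergaeleOgataSimsJSP2006, Thm. 2.1 (proof: the inequality for `C_B(X,t)`)] -/
theorem weighted_norm_commutator_le_of_closed_family {κ : Type*} [Fintype κ] {H : Matrix n n ℂ}
    (hH : H.IsHermitian) (B : Matrix n n ℂ) (O P : κ → Matrix n n ℂ)
    (hP : ∀ k, (P k).IsHermitian) (hOP : ∀ k, Commute (O k) (P k)) (S : κ → Finset κ)
    (hS : ∀ k, H - P k = ∑ j ∈ S k, O j) (w : κ → ℝ) (hw : ∀ k, 0 < w k) {K δ : ℝ}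
    (hK : ∀ k, 2 * ‖O k‖ * (w k * ∑ j ∈ S k, (w j)⁻¹) ≤ K)
    (hδ : ∀ k, w k * ‖O k * B - B * O k‖ ≤ δ) (k : κ) (t : ℝ) :
    w k * ‖heisenbergEvolution H t (O k) * B - B * heisenbergEvolution H t (O k)‖ ≤
      δ * Real.exp (K * |t|) := by
  -- the interaction-picture observables, their derivatives, and the weighted commutator family
  set G : κ → ℝ → Matrix n n ℂ := fun k u =>
    exp (u • (I • P k)) * heisenbergEvolution H (-u) B * exp (u • (-(I • P k))) with hG
  set G' : κ → ℝ → Matrix n n ℂ := fun k u =>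
    -(exp (u • (I • P k)) * ((I • H - I • P k) * heisenbergEvolution H (-u) B -
      heisenbergEvolution H (-u) B * (I • H - I • P k)) * exp (u • (-(I • P k)))) with hG'
  set f : ℝ → κ → Matrix n n ℂ := fun u k => w k • (O k * G k u - G k u * O k) with hf
  set f' : ℝ → κ → Matrix n n ℂ := fun u k => w k • (O k * G' k u - G' k u * O k) with hf'
  have hderiv : ∀ u, HasDerivAt f (f' u) u := fun u => by
    refine hasDerivAt_pi.2 fun k => ?_
    have hGk : HasDerivAt (G k) (G' k u) u := hasDerivAt_interactionPicture H (P k) B u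
    exact ((hGk.const_mul (O k)).sub (hGk.mul_const (O k))).const_smul (w k)
  -- the components of `f u` are the weighted commutators `w k ‖[τ_u(O k), B]‖`
  have hfk : ∀ u k, ‖f u k‖ =
      w k * ‖heisenbergEvolution H u (O k) * B - B * heisenbergEvolution H u (O k)‖ := by
    intro u k
    rw [hf]
    dsimp only
    rw [norm_smul, Real.norm_of_nonneg (hw k).le, hG]
    dsimp only
    rw [norm_comm_heisenbergEvolution_eq_interactionPicture hH (hP k) (hOP k).symm B u]
  have hKnonneg : 0 ≤ K := by
    refine le_trans ?_ (hK k)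
    refine mul_nonneg (mul_nonneg zero_le_two (norm_nonneg _)) (mul_nonneg (hw k).le ?_)
    exact Finset.sum_nonneg fun j _ => inv_nonneg.2 (hw j).le
  have hbound : ∀ u, ‖f' u‖ ≤ K * ‖f u‖ := fun u => by
    refine (pi_norm_le_iff_of_nonneg (mul_nonneg hKnonneg (norm_nonneg _))).2 fun k => ?_
    rw [hf']
    dsimp only
    rw [norm_smul, Real.norm_of_nonneg (hw k).le]
    have h1 : ‖G' k u‖ ≤ ∑ j ∈ S k, (w j)⁻¹ * ‖f u‖ := by
      rw [hG']
      dsimp only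
      rw [norm_interactionPicture_deriv hH (hP k) B u, hS k, heisenbergEvolution_sum]
      refine (norm_sum_commutator_le (S k) _ B).trans (Finset.sum_le_sum fun j _ => ?_)
      rw [le_inv_mul_iff₀ (hw j), ← hfk u j]
      exact norm_le_pi_norm (f u) j
    calc w k * ‖O k * G' k u - G' k u * O k‖ ≤ w k * (2 * ‖O k‖ * ‖G' k u‖) :=
          mul_le_mul_of_nonneg_left (norm_commutator_le _ _) (hw k).le
      _ ≤ w k * (2 * ‖O k‖ * ∑ j ∈ S k, (w j)⁻¹ * ‖f u‖) :=
          mul_le_mul_of_nonneg_left (mul_le_mul_of_nonneg_left h1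
            (mul_nonneg zero_le_two (norm_nonneg _))) (hw k).le
      _ = 2 * ‖O k‖ * (w k * ∑ j ∈ S k, (w j)⁻¹) * ‖f u‖ := by
          rw [← Finset.sum_mul]; ring
      _ ≤ K * ‖f u‖ := mul_le_mul_of_nonneg_right (hK k) (norm_nonneg _)
  have hδnonneg : 0 ≤ δ := le_trans (mul_nonneg (hw k).le (norm_nonneg _)) (hδ k)
  have h0 : ‖f 0‖ ≤ δ := by
    refine (pi_norm_le_iff_of_nonneg hδnonneg).2 fun k => ?_
    rw [hfk 0 k, heisenbergEvolution_zero]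
    exact hδ k
  have hmain := norm_le_mul_exp_of_norm_deriv_le hderiv hbound t
  calc w k * ‖heisenbergEvolution H t (O k) * B - B * heisenbergEvolution H t (O k)‖
        = ‖f t k‖ := (hfk t k).symm
    _ ≤ ‖f t‖ := norm_le_pi_norm (f t) k
    _ ≤ ‖f 0‖ * Real.exp (K * |t|) := hmain
    _ ≤ δ * Real.exp (K * |t|) := mul_le_mul_of_nonneg_right h0 (Real.exp_pos _).le

end AbstractLR

section FiniteSystem

variable {Λ : Type*} [Fintype Λ] [DecidableEq Λ] {q : ℕ}

/-- `‖[τ_t(A), B]‖ = ‖[τ_{-t}(B), A]‖` for Hermitian `H` (the automorphism property of `τ_t`).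
NOS06 proof of Thm 2.1 ("the automorphism property of `τ_t`"). [folklore] -/
theorem norm_commutator_heisenbergEvolution_symm {n : Type*} [Fintype n] [DecidableEq n]
    {H : Matrix n n ℂ} (hH : H.IsHermitian) (t : ℝ) (A B : Matrix n n ℂ) :
    ‖heisenbergEvolution H t A * B - B * heisenbergEvolution H t A‖ =
      ‖heisenbergEvolution H (-t) B * A - A * heisenbergEvolution H (-t) B‖ := by
  calc ‖heisenbergEvolution H t A * B - B * heisenbergEvolution H t A‖
        = ‖A * heisenbergEvolution H (-t) B - heisenbergEvolution H (-t) B * A‖ :=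
          (norm_commutator_heisenbergEvolution_neg hH t A B).symm
    _ = ‖heisenbergEvolution H (-t) B * A - A * heisenbergEvolution H (-t) B‖ := by
          rw [← norm_neg, neg_sub]

/-- A sum of terms of a local interaction is Hermitian. NS06 §2. [folklore] -/
theorem isHermitian_sum_interaction {Ψ : Interaction Λ q} (hΨ : Ψ.IsLocal)
    (s : Finset (Finset Λ)) : (∑ Z ∈ s, Ψ Z).IsHermitian := by
  rw [Matrix.IsHermitian, Matrix.conjTranspose_sum]
  exact Finset.sum_congr rfl fun Z _ => (hΨ.isHermitian Z).eq

/-- The exterior Hamiltonian `Σ_{Z' ∩ Z = ∅} Ψ Z'` commutes with `𝔄_Z` (locality). NS06 §2. [folklore] -/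
theorem commute_sum_filter_disjoint {Ψ : Interaction Λ q} (hΨ : Ψ.IsLocal) {A : Op Λ q}
    {Z : Finset Λ} (hA : IsSupportedOn A Z) :
    Commute A (∑ Z' ∈ univ.filter (fun Z' => Disjoint Z Z'), Ψ Z') :=
  Commute.sum_right _ _ _ fun Z' hZ' =>
    commute_of_disjoint_holds hA (hΨ.isSupportedOn Z') (Finset.mem_filter.1 hZ').2

/-- `H_Λ - Σ_{Z' ∩ Z = ∅} Ψ Z' = Σ_{Z' ∩ Z ≠ ∅} Ψ Z'`: the operator `H_X = Σ_{Z ∩ X ≠ ∅} Φ(Z)` of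
the proof of NOS06 Thm 2.1 is the full Hamiltonian minus the terms not touching `X`.
[cite: NachtergaeleOgataSimsJSP2006, proof of Thm. 2.1 (definition of `H_Y`)] -/
theorem localHamiltonian_univ_sub_sum_filter_disjoint (Ψ : Interaction Λ q) (Z : Finset Λ) :
    localHamiltonian Ψ univ - ∑ Z' ∈ univ.filter (fun Z' => Disjoint Z Z'), Ψ Z' =
      ∑ Z' ∈ univ.filter (fun Z' => ¬ Disjoint Z Z'), Ψ Z' := by
  rw [localHamiltonian, Finset.powerset_univ, sub_eq_iff_eq_add, add_comm,
    Finset.sum_filter_add_sum_filter_not]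

/-- For local dimension `q = 0` the configuration space `Λ → Fin 0` has at most one point, so all
observables commute. [folklore] -/
theorem mul_comm_of_q_eq_zero (A B : Op Λ 0) : A * B = B * A := by
  ext i j
  simp only [Matrix.mul_apply, Fintype.sum_subsingleton _ i]
  rw [Subsingleton.elim j i, mul_comm]

end FiniteSystem

section Lattice

open Literature.Probability.LatticeModels

variable {d q : ℕ}

/-- The terms of the restricted interaction are bounded by the bound of `Φ`:
`‖Φ X ⊗ 𝟙‖ = ‖Φ X‖ ≤ J` (`q ≠ 0`). NS06 §2. [folklore] -/
theorem norm_restrict_apply_le [NeZero q] {Φ : LatticeInteraction d q} {J : ℝ} (hJ : Φ.IsBounded J)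
    (Λ : Finset (Site d)) (Z : Finset ↥Λ) : ‖Φ.restrict Λ Z‖ ≤ J := by
  change ‖localOp Z (transportOp _ (Φ _))‖ ≤ J
  rw [norm_localOp_holds Z, transportOp,
    Literature.Computability.QuantumComplexity.l2_opNorm_reindex]
  exact hJ _

/-- A vanishing term of `Φ` restricts to a vanishing term. [folklore] -/
theorem restrict_apply_eq_zero {Φ : LatticeInteraction d q} (Λ : Finset (Site d)) (Z : Finset ↥Λ)
    (h : Φ (Z.map (Function.Embedding.subtype _)) = 0) : Φ.restrict Λ Z = 0 := by
  change localOp Z (transportOp _ (Φ _)) = 0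
  rw [h]
  simp [transportOp]

/-- A non-vanishing restricted term of a range-`R` interaction lives on a region of diameter `≤ R`.
NS06 §2 (finite range). [folklore] -/
theorem dist_le_of_restrict_ne_zero {Φ : LatticeInteraction d q} {R : ℝ} (hR : Φ.HasFiniteRange R)
    {Λ : Finset (Site d)} {Z : Finset ↥Λ} (hZ : Φ.restrict Λ Z ≠ 0) {x z : ↥Λ} (hx : x ∈ Z)
    (hz : z ∈ Z) : dist (x : Site d) (z : Site d) ≤ R := by
  have hdiam : ¬ R < Metric.diam
      (((Z.map (Function.Embedding.subtype (· ∈ Λ)) : Finset (Site d)) : Set (Site d))) :=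
    fun h => hZ (restrict_apply_eq_zero Λ Z (hR _ h))
  refine (Metric.dist_le_diam_of_mem (Set.Finite.isBounded (Finset.finite_toSet _)) ?_ ?_).trans
    (not_lt.1 hdiam)
  · exact Finset.mem_coe.2 (Finset.mem_map_of_mem (Function.Embedding.subtype (· ∈ Λ)) hx)
  · exact Finset.mem_coe.2 (Finset.mem_map_of_mem (Function.Embedding.subtype (· ∈ Λ)) hz)

/-- Lattice points of a volume within sup-distance `r` of a point: at most `(2⌊r⌋+1)^d` (they lie in
a translate of `box d ⌊r⌋`). [folklore] -/
theorem card_filter_dist_le (Λ : Finset (Site d)) (z : Site d) {r : ℝ} (hr : 0 ≤ r) :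
    #(univ.filter fun x : ↥Λ => dist (x : Site d) z ≤ r) ≤ (2 * ⌊r⌋₊ + 1) ^ d := by
  rw [← card_box d ⌊r⌋₊]
  refine Finset.card_le_card_of_injOn (fun x : ↥Λ => (x : Site d) - z) (fun x hx => ?_) ?_
  · have hx' : dist (x : Site d) z ≤ r := (Finset.mem_filter.1 (Finset.mem_coe.1 hx)).2
    rw [Finset.mem_coe, mem_box]
    intro i
    have hi : dist ((x : Site d) i) (z i) ≤ r := (dist_pi_le_iff hr).1 hx' i
    rw [Int.dist_eq, ← Int.cast_sub, ← Int.cast_abs] at hi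
    have hnat : ((x : Site d) i - z i).natAbs ≤ ⌊r⌋₊ := by
      refine Nat.le_floor ?_
      have : (((x : Site d) i - z i).natAbs : ℝ) = (((|(x : Site d) i - z i| : ℤ)) : ℝ) := by
        rw [Nat.cast_natAbs]
      rw [this]
      exact hi
    have hint : |(x : Site d) i - z i| ≤ (⌊r⌋₊ : ℤ) := by
      rw [← Int.natCast_natAbs]
      exact_mod_cast hnat
    simpa [Pi.sub_apply] using abs_le.1 hint
  · intro x _ y _ hxy
    exact Subtype.ext (sub_left_injective hxy)

/-- A family of regions through a common site `z`, each carrying a non-zero term of a range-`R`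
interaction, has at most `2^{(2⌊R⌋+1)^d}` members. NS06 §2 (finite range). [folklore] -/
theorem card_le_of_forall_mem_active {Φ : LatticeInteraction d q} {R : ℝ} (hR : Φ.HasFiniteRange R)
    (Λ : Finset (Site d)) (z : ↥Λ) (T : Finset (Finset ↥Λ))
    (hT : ∀ Z ∈ T, z ∈ Z ∧ Φ.restrict Λ Z ≠ 0) : #T ≤ 2 ^ ((2 * ⌊max R 0⌋₊ + 1) ^ d) := by
  set ball := univ.filter fun x : ↥Λ => dist (x : Site d) z ≤ max R 0
  calc #T ≤ #ball.powerset := Finset.card_le_card fun Z hZ => Finset.mem_powerset.2 fun x hx =>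
          Finset.mem_filter.2 ⟨Finset.mem_univ _,
            (dist_le_of_restrict_ne_zero hR (hT Z hZ).2 hx (hT Z hZ).1).trans (le_max_left _ _)⟩
    _ = 2 ^ #ball := Finset.card_powerset _
    _ ≤ 2 ^ ((2 * ⌊max R 0⌋₊ + 1) ^ d) :=
          Nat.pow_le_pow_right (by norm_num) (card_filter_dist_le Λ z (le_max_right _ _))

/-- A region carrying a non-zero term of a range-`R` interaction has at most `(2⌊R⌋+1)^d` sites.
NS06 §2. [folklore] -/
theorem card_le_of_restrict_ne_zero {Φ : LatticeInteraction d q} {R : ℝ} (hR : Φ.HasFiniteRange R)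
    (Λ : Finset (Site d)) {Z : Finset ↥Λ} (hZ : Φ.restrict Λ Z ≠ 0) :
    #Z ≤ (2 * ⌊max R 0⌋₊ + 1) ^ d := by
  rcases Z.eq_empty_or_nonempty with rfl | ⟨z, hz⟩
  · simp
  · calc #Z ≤ #(univ.filter fun x : ↥Λ => dist (x : Site d) z ≤ max R 0) :=
          Finset.card_le_card fun x hx => Finset.mem_filter.2 ⟨Finset.mem_univ _,
            (dist_le_of_restrict_ne_zero hR hZ hx hz).trans (le_max_left _ _)⟩
      _ ≤ _ := card_filter_dist_le Λ z (le_max_right _ _)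

/-- The regions meeting `Z` and carrying a non-zero term number at most `|Z| 2^{(2⌊R⌋+1)^d}`.
NS06 §2. [folklore] -/
theorem card_le_of_forall_mem_meets_active {Φ : LatticeInteraction d q} {R : ℝ}
    (hR : Φ.HasFiniteRange R) (Λ : Finset (Site d)) (Z : Finset ↥Λ) (T : Finset (Finset ↥Λ))
    (hT : ∀ Z' ∈ T, ¬ Disjoint Z Z' ∧ Φ.restrict Λ Z' ≠ 0) :
    #T ≤ #Z * 2 ^ ((2 * ⌊max R 0⌋₊ + 1) ^ d) := by
  have hsub : T ⊆ Z.biUnion fun z => T.filter fun Z' => z ∈ Z' := by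
    intro Z' hZ'
    obtain ⟨z, hzZ, hzZ'⟩ := Finset.not_disjoint_iff.1 (hT Z' hZ').1
    exact Finset.mem_biUnion.2 ⟨z, hzZ, Finset.mem_filter.2 ⟨hZ', hzZ'⟩⟩
  calc #T ≤ #(Z.biUnion fun z => T.filter fun Z' => z ∈ Z') := Finset.card_le_card hsub
    _ ≤ ∑ z ∈ Z, #(T.filter fun Z' => z ∈ Z') := Finset.card_biUnion_le
    _ ≤ ∑ z ∈ Z, 2 ^ ((2 * ⌊max R 0⌋₊ + 1) ^ d) := Finset.sum_le_sum fun z _ =>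
        card_le_of_forall_mem_active hR Λ z _ fun Z' hZ' =>
          ⟨(Finset.mem_filter.1 hZ').2, (hT Z' (Finset.mem_filter.1 hZ').1).2⟩
    _ = #Z * 2 ^ ((2 * ⌊max R 0⌋₊ + 1) ^ d) := by rw [Finset.sum_const, smul_eq_mul]

/-- `d(X, Y) = 0` if `X` and `Y` meet. NS06 §2. [folklore] -/
theorem setDist_eq_zero_of_mem {X Y : Finset (Site d)} {x : Site d} (hx : x ∈ X) (hy : x ∈ Y) :
    setDist X Y = 0 :=
  le_antisymm ((setDist_le_dist hx hy).trans_eq (dist_self x)) (setDist_nonneg X Y)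

/-- `setDist X ∅ = 0` (junk value). [folklore] -/
theorem setDist_empty_right (X : Finset (Site d)) : setDist X ∅ = 0 :=
  Real.iInf_of_isEmpty _

/-- If `X` meets a region `Z` of diameter `≤ r`, then `d(X, Y) ≤ d(Z, Y) + r`. NS06 §2. [folklore] -/
theorem setDist_le_setDist_add {X Z Y : Finset (Site d)} {r : ℝ} (hr : 0 ≤ r) {x : Site d}
    (hxX : x ∈ X) (hxZ : x ∈ Z) (hZ : ∀ a ∈ Z, ∀ b ∈ Z, dist a b ≤ r) :
    setDist X Y ≤ setDist Z Y + r := by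
  rcases Y.eq_empty_or_nonempty with rfl | ⟨y, hy⟩
  · rw [setDist_empty_right, setDist_empty_right, zero_add]
    exact hr
  · haveI : Nonempty (↥Z × ↥Y) := ⟨(⟨x, hxZ⟩, ⟨y, hy⟩)⟩
    rw [← sub_le_iff_le_add]
    refine le_ciInf fun p => ?_
    calc setDist X Y - r ≤ dist x (p.2 : Site d) - r := sub_le_sub_right (setDist_le_dist hxX p.2.2) _
      _ ≤ dist x (p.1 : Site d) + dist (p.1 : Site d) p.2 - r :=
          sub_le_sub_right (dist_triangle _ _ _) _
      _ ≤ r + dist (p.1 : Site d) p.2 - r := by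
          have := hZ x hxZ p.1 p.1.2
          linarith
      _ = dist (p.1 : Site d) p.2 := by ring

/-- Weight comparison: if `Z` meets a region `Z'` carrying a non-zero term, then
`d(Z, Y) ≤ d(Z', Y) + max R 0`. NS06 §2. [folklore] -/
theorem setDist_map_le_of_meets_active {Φ : LatticeInteraction d q} {R : ℝ}
    (hR : Φ.HasFiniteRange R) {Λ : Finset (Site d)} {Z Z' : Finset ↥Λ} (hZZ' : ¬ Disjoint Z Z')
    (hZ' : Φ.restrict Λ Z' ≠ 0) (Y : Finset (Site d)) :
    setDist (Z.map (Function.Embedding.subtype (· ∈ Λ))) Y ≤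
      setDist (Z'.map (Function.Embedding.subtype (· ∈ Λ))) Y + max R 0 := by
  obtain ⟨z, hzZ, hzZ'⟩ := Finset.not_disjoint_iff.1 hZZ'
  refine setDist_le_setDist_add (le_max_right _ _)
    (Finset.mem_map_of_mem (Function.Embedding.subtype (· ∈ Λ)) hzZ)
    (Finset.mem_map_of_mem (Function.Embedding.subtype (· ∈ Λ)) hzZ') fun a ha b hb => ?_
  obtain ⟨a', ha', rfl⟩ := Finset.mem_map.1 ha
  obtain ⟨b', hb', rfl⟩ := Finset.mem_map.1 hb
  exact (dist_le_of_restrict_ne_zero hR hZ' ha' hb').trans (le_max_left _ _)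

/-- `inVolume Λ X`, pushed back to `ℤ^d`, is `X` for `X ⊆ Λ`. NS06 §2. [folklore] -/
theorem map_subtype_inVolume {Λ X : Finset (Site d)} (hX : X ⊆ Λ) :
    (inVolume Λ X).map (Function.Embedding.subtype (· ∈ Λ)) = X := by
  rw [inVolume, Finset.subtype_map, Finset.filter_true_of_mem hX]

/-- `|inVolume Λ X| = |X|` for `X ⊆ Λ`. NS06 §2. [folklore] -/
theorem card_inVolume {Λ X : Finset (Site d)} (hX : X ⊆ Λ) : #(inVolume Λ X) = #X := by
  conv_rhs => rw [← map_subtype_inVolume hX]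
  rw [Finset.card_map]

end Lattice

section Main

open Literature.Probability.LatticeModels

variable {d q : ℕ}

/-- **Lieb–Robinson bound in a finite volume, one-sided `|X|` form with explicit constants**
(NOS06 Thm 2.1 in the `min(|X|,|Y|)` form of the display following its proof: `C = 2`, `μ = 1`,
`v = K ≥ 2 max(J,1) M N e^{max(R,0)}`, `M = (2⌊R⌋+1)^d`, `N = 2^M`). For a Hermitian interaction
`Φ` on `ℤ^d` of range `R` with `‖Φ Z‖ ≤ J`, every finite volume `Λ`, regions `X, Y ⊆ Λ`,
`A ∈ 𝔄_X`, `B ∈ 𝔄_Y` and `t ∈ ℝ`: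
`‖[τ_t^Λ(A), B]‖ ≤ 2 ‖A‖ ‖B‖ |X| e^{-(d(X,Y) - K|t|)}`. Proof: the weighted Grönwall theorem
`weighted_norm_commutator_le_of_closed_family` applied to the probe family
`(X, A), (Z, Φ|_Λ Z)_{Z ⊆ Λ}` with weights `e^{d(Z,Y)}`.
[cite: NachtergaeleOgataSimsJSP2006, Thm. 2.1 (one-sided `|X|` form)] -/
theorem lieb_robinson_bound_left (Φ : LatticeInteraction d q) {R J K : ℝ} (hH : Φ.IsHermitian)
    (hR : Φ.HasFiniteRange R) (hJ : Φ.IsBounded J)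
    (hK : 2 * max J 1 * ((2 * ⌊max R 0⌋₊ + 1) ^ d : ℕ) * (2 ^ ((2 * ⌊max R 0⌋₊ + 1) ^ d) : ℕ) *
      Real.exp (max R 0) ≤ K)
    (Λ : Finset (Site d)) (X Y : Finset ↥Λ) (A B : Op ↥Λ q) (hA : IsSupportedOn A X)
    (hB : IsSupportedOn B Y) (t : ℝ) :
    ‖heisenbergEvolution (localHamiltonian (Φ.restrict Λ) univ) t A * B -
        B * heisenbergEvolution (localHamiltonian (Φ.restrict Λ) univ) t A‖ ≤
      2 * ‖A‖ * ‖B‖ * #X * Real.exp (-(setDist (X.map (Function.Embedding.subtype (· ∈ Λ)))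
        (Y.map (Function.Embedding.subtype (· ∈ Λ))) - K * |t|)) := by
  classical
  set emb : ↥Λ ↪ Site d := Function.Embedding.subtype (· ∈ Λ) with hemb
  set Ψ : Interaction ↥Λ q := Φ.restrict Λ with hΨdef
  set M : ℕ := (2 * ⌊max R 0⌋₊ + 1) ^ d with hMdef
  set N : ℕ := 2 ^ M with hNdef
  set J₁ : ℝ := max J 1 with hJ₁def
  set Xv : Finset (Site d) := X.map emb with hXv
  set Yv : Finset (Site d) := Y.map emb with hYv
  have hΨ : Ψ.IsLocal := hH.isLocal_restrict Λ
  have hHΛ : (localHamiltonian Ψ univ).IsHermitian := localHamiltonian_isHermitian hΨ univ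
  have hJ0 : 0 ≤ J := (norm_nonneg _).trans (hJ ∅)
  have hJ1 : J ≤ J₁ := le_max_left _ _
  have hJ₁pos : 0 < J₁ := lt_of_lt_of_le one_pos (le_max_right _ _)
  have hM1 : 1 ≤ M := Nat.one_le_pow _ _ (by omega)
  have hN1 : 1 ≤ N := Nat.one_le_two_pow
  have hM1' : (1 : ℝ) ≤ M := by exact_mod_cast hM1
  have hMpos : (0 : ℝ) < M := by exact_mod_cast hM1
  have hNpos : (0 : ℝ) < N := by exact_mod_cast hN1
  set K₀ : ℝ := 2 * J₁ * M * N * Real.exp (max R 0) with hK₀def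
  have hK₀K : K₀ ≤ K := hK
  have hK₀nonneg : 0 ≤ K₀ := by positivity
  have hRHS : 0 ≤ 2 * ‖A‖ * ‖B‖ * #X * Real.exp (-(setDist Xv Yv - K * |t|)) := by positivity
  -- degenerate cases: `q = 0`, `A = 0`, `X = ∅`
  by_cases hq : q = 0
  · subst hq
    rw [mul_comm_of_q_eq_zero, sub_self, norm_zero]
    exact hRHS
  haveI : NeZero q := ⟨hq⟩
  by_cases hA0 : A = 0
  · subst hA0
    have h0 : heisenbergEvolution (localHamiltonian Ψ univ) t (0 : Op ↥Λ q) = 0 := by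
      simp [heisenbergEvolution]
    rw [h0, zero_mul, mul_zero, sub_self, norm_zero]
    positivity
  rcases X.eq_empty_or_nonempty with hXe | hXne
  · subst hXe
    obtain ⟨a, rfl⟩ := exists_eq_smul_one_of_isSupportedOn_empty hA
    rw [heisenbergEvolution_smul_one, Matrix.smul_mul, Matrix.mul_smul, one_mul, mul_one, sub_self,
      norm_zero]
    exact hRHS
  -- main case
  have hApos : 0 < ‖A‖ := norm_pos_iff.2 hA0
  have hXpos : (0 : ℝ) < #X := by exact_mod_cast hXne.card_pos
  have hX1 : (1 : ℝ) ≤ #X := by exact_mod_cast hXne.card_pos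
  -- the probe family, indexed by `Option (Finset Λ)`: `none ↦ (X, A)`, `some Z ↦ (Z, Ψ Z)`
  set Rg : Option (Finset ↥Λ) → Finset ↥Λ := fun k => k.elim X id with hRg
  set O : Option (Finset ↥Λ) → Op ↥Λ q := fun k => k.elim A fun Z => Ψ Z with hO
  set P : Option (Finset ↥Λ) → Op ↥Λ q := fun k =>
    ∑ Z' ∈ univ.filter (fun Z' => Disjoint (Rg k) Z'), Ψ Z' with hP
  set T : Finset ↥Λ → Finset (Finset ↥Λ) := fun Z =>
    univ.filter fun Z' => ¬ Disjoint Z Z' ∧ Ψ Z' ≠ 0 with hT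
  set S : Option (Finset ↥Λ) → Finset (Option (Finset ↥Λ)) := fun k =>
    (T (Rg k)).map Function.Embedding.some with hS
  set wA : ℝ := J₁ * M * Real.exp (setDist Xv Yv) / (‖A‖ * #X) with hwA
  set w : Option (Finset ↥Λ) → ℝ := fun k =>
    k.elim wA fun Z => Real.exp (setDist (Z.map emb) Yv) with hw
  set δ : ℝ := 2 * J₁ * M * ‖B‖ with hδ
  have hwApos : 0 < wA := by positivity
  have hδnonneg : 0 ≤ δ := by positivity
  -- hypotheses of the abstract theorem
  have hPherm : ∀ k, (P k).IsHermitian := fun k => isHermitian_sum_interaction hΨ _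
  have hOP : ∀ k, Commute (O k) (P k) := by
    rintro (_ | Z)
    · exact commute_sum_filter_disjoint hΨ hA
    · exact commute_sum_filter_disjoint hΨ (hΨ.isSupportedOn Z)
  have hTmem : ∀ Z Z', Z' ∈ T Z ↔ ¬ Disjoint Z Z' ∧ Ψ Z' ≠ 0 := fun Z Z' => by
    simp [hT]
  have hS' : ∀ k, localHamiltonian Ψ univ - P k = ∑ j ∈ S k, O j := by
    intro k
    rw [hS]
    dsimp only
    rw [Finset.sum_map]
    change _ = ∑ Z' ∈ T (Rg k), Ψ Z'
    rw [hT]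
    dsimp only
    rw [← Finset.filter_filter, Finset.sum_filter_ne_zero]
    exact localHamiltonian_univ_sub_sum_filter_disjoint Ψ (Rg k)
  have hwpos : ∀ k, 0 < w k := by
    rintro (_ | Z)
    exacts [hwApos, Real.exp_pos _]
  have hTcard : ∀ Z, (#(T Z) : ℝ) ≤ #Z * N := fun Z => by
    have h := card_le_of_forall_mem_meets_active hR Λ Z (T Z) fun Z' hZ' => (hTmem Z Z').1 hZ'
    exact_mod_cast h
  have hsumS : ∀ k, ∑ j ∈ S k, (w j)⁻¹ = ∑ Z' ∈ T (Rg k), Real.exp (-setDist (Z'.map emb) Yv) := by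
    intro k
    rw [hS]
    dsimp only
    rw [Finset.sum_map]
    refine Finset.sum_congr rfl fun Z' _ => ?_
    change (Real.exp (setDist (Z'.map emb) Yv))⁻¹ = _
    rw [Real.exp_neg]
  have hratio : ∀ Z Z', Z' ∈ T Z →
      setDist (Z.map emb) Yv ≤ setDist (Z'.map emb) Yv + max R 0 := fun Z Z' hZ' =>
    setDist_map_le_of_meets_active hR ((hTmem Z Z').1 hZ').1 ((hTmem Z Z').1 hZ').2 Yv
  have hK' : ∀ k, 2 * ‖O k‖ * (w k * ∑ j ∈ S k, (w j)⁻¹) ≤ K₀ := by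
    rintro (_ | Z)
    · -- the probe `(X, A)`
      rw [hsumS]
      change 2 * ‖A‖ * (wA * ∑ Z' ∈ T X, Real.exp (-setDist (Z'.map emb) Yv)) ≤ K₀
      have hterm : ∀ Z' ∈ T X, Real.exp (-setDist (Z'.map emb) Yv) ≤
          Real.exp (max R 0 - setDist Xv Yv) := fun Z' hZ' => by
        rw [Real.exp_le_exp]
        have h := hratio X Z' hZ'
        linarith
      calc 2 * ‖A‖ * (wA * ∑ Z' ∈ T X, Real.exp (-setDist (Z'.map emb) Yv))
          ≤ 2 * ‖A‖ * (wA * ∑ Z' ∈ T X, Real.exp (max R 0 - setDist Xv Yv)) :=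
            mul_le_mul_of_nonneg_left (mul_le_mul_of_nonneg_left (Finset.sum_le_sum hterm)
              hwApos.le) (by positivity)
        _ = 2 * ‖A‖ * (wA * (#(T X) * Real.exp (max R 0 - setDist Xv Yv))) := by
            rw [Finset.sum_const, nsmul_eq_mul]
        _ ≤ 2 * ‖A‖ * (wA * (#X * N * Real.exp (max R 0 - setDist Xv Yv))) :=
            mul_le_mul_of_nonneg_left (mul_le_mul_of_nonneg_left
              (mul_le_mul_of_nonneg_right (hTcard X) (Real.exp_pos _).le) hwApos.le)
              (by positivity)
        _ = K₀ := by
            rw [hwA, hK₀def, Real.exp_sub]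
            field_simp
    · -- the probe `(Z, Ψ Z)`
      by_cases hZ0 : Ψ Z = 0
      · have h0 : O (some Z) = 0 := hZ0
        rw [h0, norm_zero, mul_zero, zero_mul]
        exact hK₀nonneg
      rw [hsumS]
      change 2 * ‖Ψ Z‖ * (Real.exp (setDist (Z.map emb) Yv) *
        ∑ Z' ∈ T Z, Real.exp (-setDist (Z'.map emb) Yv)) ≤ K₀
      rw [Finset.mul_sum]
      have hterm : ∀ Z' ∈ T Z, Real.exp (setDist (Z.map emb) Yv) *
          Real.exp (-setDist (Z'.map emb) Yv) ≤ Real.exp (max R 0) := fun Z' hZ' => by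
        rw [← Real.exp_add, Real.exp_le_exp]
        have h := hratio Z Z' hZ'
        linarith
      have hnorm : ‖Ψ Z‖ ≤ J₁ := (norm_restrict_apply_le hJ Λ Z).trans hJ1
      have hcardZ : (#Z : ℝ) ≤ M := by exact_mod_cast card_le_of_restrict_ne_zero hR Λ hZ0
      have hTZ : (#(T Z) : ℝ) ≤ M * N :=
        (hTcard Z).trans (mul_le_mul_of_nonneg_right hcardZ hNpos.le)
      calc 2 * ‖Ψ Z‖ * ∑ Z' ∈ T Z, Real.exp (setDist (Z.map emb) Yv) *
            Real.exp (-setDist (Z'.map emb) Yv)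
          ≤ 2 * J₁ * ∑ Z' ∈ T Z, Real.exp (max R 0) :=
            mul_le_mul (by linarith) (Finset.sum_le_sum hterm)
              (Finset.sum_nonneg fun _ _ => by positivity) (by positivity)
        _ = 2 * J₁ * (#(T Z) * Real.exp (max R 0)) := by rw [Finset.sum_const, nsmul_eq_mul]
        _ ≤ 2 * J₁ * (M * N * Real.exp (max R 0)) :=
            mul_le_mul_of_nonneg_left (mul_le_mul_of_nonneg_right hTZ (Real.exp_pos _).le)
              (by positivity)
        _ = K₀ := by rw [hK₀def]; ring
  have hδ' : ∀ k, w k * ‖O k * B - B * O k‖ ≤ δ := by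
    rintro (_ | Z)
    · change wA * ‖A * B - B * A‖ ≤ δ
      by_cases hd : Disjoint X Y
      · rw [(commute_of_disjoint_holds hA hB hd).eq, sub_self, norm_zero, mul_zero]
        exact hδnonneg
      · obtain ⟨a, haX, haY⟩ := Finset.not_disjoint_iff.1 hd
        have hd0 : setDist Xv Yv = 0 :=
          setDist_eq_zero_of_mem (Finset.mem_map_of_mem emb haX) (Finset.mem_map_of_mem emb haY)
        have hwA' : wA = J₁ * M / (‖A‖ * #X) := by rw [hwA, hd0, Real.exp_zero, mul_one]
        rw [hwA']
        calc J₁ * M / (‖A‖ * #X) * ‖A * B - B * A‖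
            ≤ J₁ * M / (‖A‖ * #X) * (2 * ‖A‖ * ‖B‖) :=
              mul_le_mul_of_nonneg_left (norm_commutator_le A B) (by positivity)
          _ = δ / #X := by rw [hδ]; field_simp
          _ ≤ δ := div_le_self hδnonneg hX1
    · change Real.exp (setDist (Z.map emb) Yv) * ‖Ψ Z * B - B * Ψ Z‖ ≤ δ
      by_cases hd : Disjoint Z Y
      · rw [(commute_of_disjoint_holds (hΨ.isSupportedOn Z) hB hd).eq, sub_self, norm_zero,
          mul_zero]
        exact hδnonneg
      · obtain ⟨a, haZ, haY⟩ := Finset.not_disjoint_iff.1 hd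
        rw [setDist_eq_zero_of_mem (Finset.mem_map_of_mem emb haZ) (Finset.mem_map_of_mem emb haY),
          Real.exp_zero, one_mul]
        have hnorm : ‖Ψ Z‖ ≤ J₁ := (norm_restrict_apply_le hJ Λ Z).trans hJ1
        calc ‖Ψ Z * B - B * Ψ Z‖ ≤ 2 * ‖Ψ Z‖ * ‖B‖ := norm_commutator_le _ _
          _ ≤ 2 * J₁ * ‖B‖ :=
              mul_le_mul_of_nonneg_right (mul_le_mul_of_nonneg_left hnorm zero_le_two)
                (norm_nonneg B)
          _ = 2 * J₁ * 1 * ‖B‖ := by ring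
          _ ≤ 2 * J₁ * M * ‖B‖ :=
              mul_le_mul_of_nonneg_right (mul_le_mul_of_nonneg_left hM1'
                (mul_nonneg zero_le_two hJ₁pos.le)) (norm_nonneg B)
          _ = δ := by rw [hδ]
  -- the abstract theorem for the probe `none = (X, A)`
  have key : wA * ‖heisenbergEvolution (localHamiltonian Ψ univ) t A * B -
      B * heisenbergEvolution (localHamiltonian Ψ univ) t A‖ ≤ δ * Real.exp (K₀ * |t|) :=
    weighted_norm_commutator_le_of_closed_family hHΛ B O P hPherm hOP S hS' w hwpos hK' hδ' none t
  rw [← le_div_iff₀' hwApos] at key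
  refine key.trans ?_
  have hexp : Real.exp (K₀ * |t|) ≤ Real.exp (K * |t|) :=
    Real.exp_le_exp.2 (mul_le_mul_of_nonneg_right hK₀K (abs_nonneg t))
  calc δ * Real.exp (K₀ * |t|) / wA ≤ δ * Real.exp (K * |t|) / wA :=
        div_le_div_of_nonneg_right (mul_le_mul_of_nonneg_left hexp hδnonneg) hwApos.le
    _ = 2 * ‖A‖ * ‖B‖ * #X * Real.exp (-(setDist Xv Yv - K * |t|)) := by
        rw [hδ, hwA, neg_sub, Real.exp_sub]
        field_simp

/-- **Discharge of `lieb_robinson` (hubbard.S17).** The Lieb–Robinson bound in the multi-site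
`min(|X|, |Y|)` form of Nachtergaele–Ogata–Sims, J. Stat. Phys. **124** (2006) 1, Theorem 2.1
(arXiv:math-ph/0603064 §2.1, "Lieb–Robinson Bound") in the `min(|X|, |Y|)` form of the display
following its proof (`‖[τ_t(A),B]‖ ≤ (2‖A‖‖B‖/C_a) ‖F‖ min(|X|,|Y|) e^{-a[d(X,Y) - (2‖Φ‖_a C_a/a)|t|]}`),
uniformly in the finite volume `Λ ⊆ ℤ^d`, here with the constants `C = 2`, `μ = 1`,
`v = 2 max(J,1) M N e^{max(R,0)}` (`M = (2⌊max(R,0)⌋+1)^d`, `N = 2^M`). The printed proof (the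
differential equation for `f(t) = [τ_t(A), B]`, norm preservation (their Lemma 4.1), the integral
inequality for `‖[τ_t(A), B]‖` and for `C_B(X, t)`, and its iteration into the series `Σ a_n`) is
followed up to the inequality for `C_B(X, t)`, in differential form; the iteration is replaced by
Grönwall's lemma for the finite family of weighted commutator functions
(`weighted_norm_commutator_le_of_closed_family`), and the `min(|X|, |Y|)` prefactor comes from the
symmetry `‖[τ_t(A), B]‖ = ‖[τ_{-t}(B), A]‖`.
[cite: NachtergaeleOgataSimsJSP2006, Thm. 2.1 & the `min(|X|,|Y|)` display following its proof] -/
theorem lieb_robinson_holds : lieb_robinson d q := by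
  intro Φ R J hH hR hJ
  set K : ℝ := 2 * max J 1 * ((2 * ⌊max R 0⌋₊ + 1) ^ d : ℕ) *
    (2 ^ ((2 * ⌊max R 0⌋₊ + 1) ^ d) : ℕ) * Real.exp (max R 0) with hKdef
  have hJ₁pos : 0 < max J 1 := lt_of_lt_of_le one_pos (le_max_right _ _)
  have hMpos : (0 : ℝ) < ((2 * ⌊max R 0⌋₊ + 1) ^ d : ℕ) := by positivity
  have hNpos : (0 : ℝ) < (2 ^ ((2 * ⌊max R 0⌋₊ + 1) ^ d) : ℕ) := by positivity
  have hKpos : 0 < K := by positivity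
  refine ⟨2, 1, K, one_pos, hKpos, ?_⟩
  intro Λ X Y hX hY A B hA hB t
  have hHΛ : (localHamiltonian (Φ.restrict Λ) univ).IsHermitian :=
    localHamiltonian_isHermitian (hH.isLocal_restrict Λ) univ
  have h1 := lieb_robinson_bound_left Φ hH hR hJ le_rfl Λ (inVolume Λ X) (inVolume Λ Y) A B hA hB t
  have h2 := lieb_robinson_bound_left Φ hH hR hJ le_rfl Λ (inVolume Λ Y) (inVolume Λ X) B A hB hA
    (-t)
  rw [map_subtype_inVolume hX, map_subtype_inVolume hY, card_inVolume hX] at h1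
  rw [map_subtype_inVolume hX, map_subtype_inVolume hY, card_inVolume hY, setDist_comm, abs_neg,
    ← norm_commutator_heisenbergEvolution_symm hHΛ] at h2
  rw [neg_mul, one_mul]
  rcases le_total #X #Y with h | h
  · rw [min_eq_left h]
    exact h1
  · rw [min_eq_right h]
    calc _ ≤ _ := h2
      _ = 2 * ‖A‖ * ‖B‖ * #Y * Real.exp (-(setDist X Y - K * |t|)) := by ring

end Main

end Literature.MathematicalPhysics.QuantumLattice
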